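import Summits.AtomisticToContinuum.BoseEinsteinCondensation.Theorems.BECThomsonPrincipleGDTransferDefs

/-!
# Route `BECThomsonPrinciple`, crux `GDTransfer` (stmt-AtomisticToContinuum-9482):
# vocabulary and registered stub statements of the line `seeded-continuity` (lead's reshaped skeleton v2)

`Defs` file (D-0016 `<Route>Defs` convention, precedent `BECThomsonPrincipleGDTransferDefs.lean` of the dead line
`dyson-dressed-witness`) for the line `seeded-continuity` of the crux
`GDTransfer : GaussianDominationCan → ∀ v admissible, PeriodicBECFor v` (`gdTransfer_iff`).  A
`Cruxes/…/Lines/*.lean` skeleton is not an importable module, so the objects the line posits and the STATEMENTS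
of its seven registered stubs live here, to be imported verbatim by the stub files
`Theorems/BECThomsonPrincipleGDTransferSeeded<Stub>.lean` (landed `--supports stmt-AtomisticToContinuum-9482`).
Nothing open is asserted: every `def … : Prop` is a statement (of a stub or of an interface between stubs), consumed
only as the type of a stub theorem or as an explicit hypothesis; the theorems proved here are glue and sanity checks.

THE LINE (strategist `planner-cstrat-…-p1`, `Cruxes/GDTransfer/STRATEGY-CENSUS.md`, reshaped by the lead
`prover-line-…-c1`).  The three dead Kennedy–Lieb–Shastry lines consume Gaussian domination through ONE variational
step measured against the global LNSS source and output at most the all-or-nothing law.  This line uses the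
UNIFORMITY of the antecedent in `(N, L)` instead: at fixed `N`, GD empties the middle band of the `n̂₀`-law of the
near-minimisers at every side `L ≥ (N/ρ)^{1/3}` (`BandEmptiness`, stub `projectedDichotomy`, the only consumer of
GD); on very large boxes condensation is free (`FreeCorner`: Dyson's upper bound + kinetic Chebyshev); the law of
the near-minimisers is LOCALLY CONSTANT in `L` (`LocalConstancy`: near-minimiser stability from the nondegeneracy of
the bosonic torus ground state, proved in tree, + the dilation `PeriodicTrialState.dilate`, for finite continuous
profiles); a locally constant side cannot change along the connected path `[(N/ρ)^{1/3}, A·N]` unless at some side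
the near-minimisers are balanced macroscopic superpositions of a depleted and a condensed branch — which the SEED
`NoBalancedCat` (the prepared sub-crux, verbatim) forbids; `CountLaw` makes the crux's inline `Q_S` masses an honest
probability law with mean `condensateOccupation`; `stub_ivtGlue` is the connectedness assembly; `stub_roughPotentials`
is the regime outside the finite-continuous class (hard cores, discontinuous profiles), fed with the soft conclusion.

v2 versus the strategist's v1 (`Cruxes/GDTransfer/Lines/seeded_continuity.lean`): `stub_groundLawContinuity`
(Perron–Frobenius ground-state law + norm-resolvent continuity in `L`) is REPLACED by `stub_localConstancy`
(near-minimisers only; template `CorrectorClosure.VolumeHomotopySumRuleDomination.vb_localConstancy` and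
`Theorems.condensateOccupation_le_of_nearMinimisers`, both in tree), the soft class is the finite-continuous class
(where the dilation transport is uniform), `CountLaw` carries the `L²`-Lipschitz bound of the law, and the
intermediate-value step is the clopen argument of `…VolumeBootstrap.stub_volumeBootstrap` run on near-minimisers.

Objects: `compMass`/`lawMass`/`loMass`/`hiMass`/`bandMass` (the `n̂₀`-law of a state through the crux's `Q_S` =
`Negative.modeProj`), `IsFiniteContinuous`; statements `NoBalancedCat`, `BandEmptiness`, `FreeCorner`, `CountLaw`,
`LocalConstancy`, the seven `Sig.stub_*`; glue `GDTransfer_of`; sanity `noBalancedCat_iff` (`Iff.rfl`),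
`roughPotentials_of_gdTransfer`, `seed_shape_of_hi_lt`.

References: KennedyLiebShastry1988; LSSY2005 Thm 2.2 and §1.2 (1.17)–(1.19), Ch. 5 footnote to (5.3) (scaling);
ReedSimonIV1978 §XIII.12 (nondegenerate ground states); arXiv:2307.10622 (Nam–Rademacher, the seed at the corner).
-/

noncomputable section

open MeasureTheory Filter
open scoped ENNReal NNReal

namespace Summit.AtomisticToContinuum.BoseEinsteinCondensation.Cruxes.GDTransfer.Seeded

open Literature.MathematicalPhysics.QuantumManyBody.BoseGas
open Summit.AtomisticToContinuum.BoseEinsteinCondensation.Theses.BECThomsonPrinciple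
open Summit.AtomisticToContinuum.BoseEinsteinCondensation.Theorems.GaussianDominationCan.Negative (modeProj)
open Summit.AtomisticToContinuum.BoseEinsteinCondensation.Cruxes.GDTransfer.DysonDressedWitness
  (PeriodicBECFor gdTransfer_iff)

variable {m : ℕ}

/-! ## §0 Vocabulary: the `n̂₀`-law of a state through the crux's `Q_S` -/

/-- `w_S(ψ) = ∫_{cell^N} |Q_S ψ|²`: the mass of the `S`-component of `ψ` (`Q_S = Π_{i∈S}P_i Π_{i∉S}(1−P_i)`,
the crux's inline `foldr` = `Negative.modeProj` definitionally); `Σ_{|S|=j} w_S = P_ψ(n̂₀ = j)`. -/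
def compMass (m : ℕ) (L : ℝ) (S : Finset (Fin (m + 1))) (ψ : Config (m + 1) → ℂ) : ℝ≥0∞ :=
  ∫⁻ X in cellN (m + 1) L, (‖modeProj (m + 1) L S ψ X‖₊ : ℝ≥0∞) ^ 2

/-- `P_ψ(n̂₀ ∈ A) = Σ_{S : |S| ∈ A} w_S(ψ)` for a set of counts `A` (a decidable predicate on `ℕ`). -/
def lawMass (m : ℕ) (L : ℝ) (p : ℕ → Prop) [DecidablePred p] (ψ : Config (m + 1) → ℂ) : ℝ≥0∞ :=
  ∑ S ∈ (Finset.univ : Finset (Finset (Fin (m + 1)))).filter (fun S => p S.card), compMass m L S ψ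

/-- `P_ψ(n̂₀ < θN)` — the DEPLETED side. -/
def loMass (m : ℕ) (L θ : ℝ) (ψ : Config (m + 1) → ℂ) : ℝ≥0∞ :=
  lawMass m L (fun j => (j : ℝ) < θ * (m + 1)) ψ

/-- `P_ψ(n̂₀ ≥ (1−β)N)` — the CONDENSED side. -/
def hiMass (m : ℕ) (L β : ℝ) (ψ : Config (m + 1) → ℂ) : ℝ≥0∞ :=
  lawMass m L (fun j => (1 - β) * (m + 1) ≤ (j : ℝ)) ψ

/-- `P_ψ(θN ≤ n̂₀ < (1−β)N)` — the MIDDLE BAND. -/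
def bandMass (m : ℕ) (L θ β : ℝ) (ψ : Config (m + 1) → ℂ) : ℝ≥0∞ :=
  lawMass m L (fun j => θ * (m + 1) ≤ (j : ℝ) ∧ (j : ℝ) < (1 - β) * (m + 1)) ψ

/-- The FINITE-CONTINUOUS class of profiles (the tree's "smooth class" hypotheses `hfin`, `hcont` of
`vb_localConstancy` / `vb_scaledPotential_close`): `v` takes finite values and `x ↦ v(|x|)` is continuous on
`ℝ³`.  With `IsRepulsiveFiniteRange` this makes `x ↦ v(|x|)` bounded and uniformly continuous, which is what the
dilation transport in `L` needs; hard cores and discontinuous profiles are `stub_roughPotentials`. -/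
def IsFiniteContinuous (v : ℝ → ℝ≥0∞) : Prop :=
  (∀ r, v r ≠ ⊤) ∧ Continuous fun x : Space => (v ‖x‖).toReal

/-! ## §1 The statements of the line -/

/-- THE SEED (verbatim the prepared sub-crux `NoBalancedCat` of `Cruxes/GDTransfer/StrategySplit.lean` /
`SPLIT.md` `children.json`, in the crux's inline `P/Q` vocabulary so that a crux split can promote it
unchanged): along the density path the `n̂₀`-law of a near-minimiser is never split evenly between
`{n̂₀ < θN}` and `{n̂₀ ≥ (1−β)N}`. -/
def NoBalancedCat : Prop :=
  open Literature.MathematicalPhysics.QuantumManyBody.BoseGas in (∀ v : ℝ → ENNReal, IsRepulsiveFiniteRange v → ∀ θ β : ℝ, 0 < θ → 0 < β → θ + β < 1 → ∃ τ : ℝ, 0 < τ ∧ τ < 1 / 2 ∧ ∃ ρ₀ : ℝ, 0 < ρ₀ ∧ ∃ N₀ : ℕ, ∀ m : ℕ, N₀ ≤ m + 1 → ∀ L : ℝ, 0 < L → ((m + 1 : ℕ) : ℝ) ≤ ρ₀ * L ^ 3 → periodicGroundStateEnergy v (m + 1) L ≠ ⊤ → ∃ δ : ENNReal, 0 < δ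 ∧ ∀ Ψ : PeriodicTrialState (m + 1) L, periodicEnergy v Ψ ≤ periodicGroundStateEnergy v (m + 1) L + δ → let P : Fin (m + 1) → (Config (m + 1) → ℂ) → (Config (m + 1) → ℂ) := fun i g X => ((L ^ 3)⁻¹ : ℝ) • ∫ y in cell L, g (Function.update X i y); let Q : Finset (Fin (m + 1)) → (Config (m + 1) → ℂ) → (Config (m + 1) → ℂ) := fun S g => (List.finRange (m + 1)).foldr (fun i h => if i ∈ S then P i h else h - P i h) g; let w : Finset (Fin (m + 1)) → ENNReal := fun S => ∫⁻ X in cellN (m + 1) L, (‖Q S Ψ.ψ X‖₊ : ENNReal) ^ 2; ¬ (ENNReal.ofReal τ ≤ ∑ S ∈ (Finset.univ : Finset (Finset (Fin (m + 1)))).filter (fun S => (S.card : ℝ) < θ * (m + 1)), w S ∧ ENNReal.ofReal τ ≤ ∑ S ∈ (Finset.univ : Finset (Finset (Fin (m + 1)))).filter (fun S => (1 - β) * (m + 1) ≤ (S.card : ℝ)), w S))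

/-- BAND EMPTINESS for one potential (output of `stub_projectedDichotomy`; "GD forbids partial condensation",
uniformly down the density scale): for all band parameters and every `ε > 0` there are `ρ₀, N₀` such that at
every `(N, L)` with `N ≥ N₀`, `N ≤ ρ₀L³` some slack `δ > 0` makes every `δ`-near-minimiser carry band mass `≤ ε`.
(The window parameter `M` of GD is chosen inside: `ε ≥ (K√ρ₀ + 4πa(1+o(1))/M²)/β`; for `L > M²N/4π²` the kinetic
tail alone bounds ALL depletion by `4πa(1+o(1))N/M²`.) -/
def BandEmptiness (v : ℝ → ℝ≥0∞) : Prop :=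
  ∀ θ β : ℝ, 0 < θ → 0 < β → θ + β < 1 → ∀ ε : ℝ, 0 < ε →
    ∃ ρ₀ : ℝ, 0 < ρ₀ ∧ ∃ N₀ : ℕ, ∀ m : ℕ, N₀ ≤ m + 1 → ∀ L : ℝ, 0 < L →
      ((m + 1 : ℕ) : ℝ) ≤ ρ₀ * L ^ 3 →
      ∃ δ : ℝ≥0∞, 0 < δ ∧ ∀ Ψ : PeriodicTrialState (m + 1) L,
        periodicEnergy v Ψ ≤ periodicGroundStateEnergy v (m + 1) L + δ →
        bandMass m L θ β Ψ.ψ ≤ ENNReal.ofReal ε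

/-- THE FREE CORNER for one potential (output of `stub_freeCorner`): for every `ε > 0` there are `A, N₀` such that
on every box of side `L ≥ A·N` (`N ≥ N₀`) some slack makes every near-minimiser `ε`-completely condensed,
`N ≤ ⟨n̂₀⟩ + εN` (Dyson: `E₀ ≤ 4πaN²(1+o(1))/L³`; kinetic Chebyshev + Parseval: `N − ⟨n̂₀⟩ ≤ E L²/4π²`). -/
def FreeCorner (v : ℝ → ℝ≥0∞) : Prop :=
  ∀ ε : ℝ, 0 < ε → ∃ A : ℝ, 0 < A ∧ ∃ N₀ : ℕ, ∀ m : ℕ, N₀ ≤ m + 1 → ∀ L : ℝ, A * (m + 1) ≤ L →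
    ∃ δ : ℝ≥0∞, 0 < δ ∧ ∀ Ψ : PeriodicTrialState (m + 1) L,
      periodicEnergy v Ψ ≤ periodicGroundStateEnergy v (m + 1) L + δ →
      ((m + 1 : ℕ) : ℝ≥0∞) ≤ condensateOccupation (m + 1) L Ψ.ψ + ENNReal.ofReal (ε * (m + 1))

/-- THE COUNT LAW (output of `stub_countLaw`; algebra of the commuting cell averages `P_i`): (1) for a periodic
trial state the component masses sum to `1` (the `Q_S` resolve the identity on `L²(cell^N)`) and their count-weighted
sum is the condensate occupation `⟨Ψ, n̂₀Ψ⟩` (`Σ_S |S| Q_S = Σ_i P_i`, Bose symmetry, the definition of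
`occupation`); (2) the law is `L²`-Lipschitz: for continuous `f, g` with `∫|g|² ≤ 1` and `∫|f − g|² ≤ η²`, every
partial sum of masses satisfies `Σ_{S∈T} w_S(f) ≤ Σ_{S∈T} w_S(g) + 2η + η²` (orthogonality `Σ_S ‖Q_S h‖² = ‖h‖²`
and Cauchy–Schwarz). -/
def CountLaw : Prop :=
  (∀ (m : ℕ) (L : ℝ), 0 < L → ∀ Ψ : PeriodicTrialState (m + 1) L,
      (∑ S : Finset (Fin (m + 1)), compMass m L S Ψ.ψ) = 1 ∧
      (∑ S : Finset (Fin (m + 1)), (S.card : ℝ≥0∞) * compMass m L S Ψ.ψ) =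
        condensateOccupation (m + 1) L Ψ.ψ) ∧
  (∀ (m : ℕ) (L : ℝ), 0 < L → ∀ (T : Finset (Finset (Fin (m + 1)))) (f g : Config (m + 1) → ℂ),
      Continuous f → Continuous g →
      (∫⁻ X in cellN (m + 1) L, (‖g X‖₊ : ℝ≥0∞) ^ 2) ≤ 1 →
      ∀ η : ℝ, 0 < η →
      (∫⁻ X in cellN (m + 1) L, (‖f X - g X‖₊ : ℝ≥0∞) ^ 2) ≤ ENNReal.ofReal (η ^ 2) →
      (∑ S ∈ T, compMass m L S f) ≤ (∑ S ∈ T, compMass m L S g) + ENNReal.ofReal (2 * η + η ^ 2))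

/-- LOCAL CONSTANCY OF THE LAW OF NEAR-MINIMISERS IN THE SIDE (output of `stub_localConstancy`; fixed `N`, no
uniformity): at every side `L₁ > 0` the periodic ground-state energy is finite, and for every `ε > 0` there are a
radius `r > 0` and a slack `δ₁ > 0` such that for every side `L'` with `|L' − L₁| < r` some slack `δ' > 0` makes the
condensed-side mass of every `δ'`-near-minimiser at `L'` and of every `δ₁`-near-minimiser at `L₁` agree within `ε`.
Mechanism (templates in tree): dilate the state at `L'` to side `L₁` (`PeriodicTrialState.dilate`: same `Q_S`
masses, near-minimiser of the scaled potential `b⁻²v(·/b)`, uniformly close to `v` for finite continuous profiles —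
`vb_scaledPotential_close`), then near-minimiser stability at `(N, L₁)` (spectral gap from
`PeriodicGroundStateNondegenerate_holds`, two-sided phase alignment — `condensateOccupation_le_of_nearMinimisers`)
and the `L²`-Lipschitz bound of `CountLaw` (2). -/
def LocalConstancy (v : ℝ → ℝ≥0∞) : Prop :=
  ∀ (m : ℕ) (β : ℝ) (L₁ : ℝ), 0 < L₁ →
    periodicGroundStateEnergy v (m + 1) L₁ ≠ ⊤ ∧
    ∀ ε : ℝ, 0 < ε → ∃ r : ℝ, 0 < r ∧ ∃ δ₁ : ℝ≥0∞, 0 < δ₁ ∧ ∀ L' : ℝ, |L' - L₁| < r →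
      ∃ δ' : ℝ≥0∞, 0 < δ' ∧
        ∀ (Ψ' : PeriodicTrialState (m + 1) L') (Ψ₁ : PeriodicTrialState (m + 1) L₁),
          periodicEnergy v Ψ' ≤ periodicGroundStateEnergy v (m + 1) L' + δ' →
          periodicEnergy v Ψ₁ ≤ periodicGroundStateEnergy v (m + 1) L₁ + δ₁ →
          (hiMass m L' β Ψ'.ψ).toReal ≤ (hiMass m L₁ β Ψ₁.ψ).toReal + ε ∧
            (hiMass m L₁ β Ψ₁.ψ).toReal ≤ (hiMass m L' β Ψ'.ψ).toReal + ε

/-! ## §2 Registered stub signatures (`Sig.stub_<name>` = the statement of the registered stub `stub_<name>`) -/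

/-- Registered signature of `stub_noBalancedCat` [the SEED; open-problem-sized — STRATEGY-CENSUS §D.1; its
statement is the prepared sub-crux `NoBalancedCat` verbatim, for promotion by a crux split]. -/
def Sig.stub_noBalancedCat : Prop :=
  NoBalancedCat

/-- Registered signature of `stub_projectedDichotomy` [XL; the ONLY consumer of Gaussian domination: the
sector-projected LNSS pair `𝟙(n̂₀ ≥ m)Λ†Ψ`, `𝟙(n̂₀ ≥ m)ΛΨ` on the landed residue chordVariation / lnssAlgebra /
bareAdmissible / windowLaw / modeCounting, cut `m` averaged over `[θN/2, θN]`, window sum + kinetic tail]: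
GD empties the middle band of the `n̂₀`-law of near-minimisers, for finite continuous profiles. -/
def Sig.stub_projectedDichotomy : Prop :=
  GaussianDominationCan → ∀ v : ℝ → ℝ≥0∞, IsRepulsiveFiniteRange v → IsFiniteContinuous v →
    BandEmptiness v

/-- Registered signature of `stub_freeCorner` [M; `LSSY2005_upperBound_periodic_holds` / `dud_groundStateEnergy_le`
+ `vb_depletion_le` (Parseval + kinetic Chebyshev), for every admissible `v`]. -/
def Sig.stub_freeCorner : Prop :=
  ∀ v : ℝ → ℝ≥0∞, IsRepulsiveFiniteRange v → FreeCorner v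

/-- Registered signature of `stub_countLaw` [M; `cellAvg_cellAvg`, `integral_conj_mul_cellAvg`, `cellAvg_comm`,
`sum_modeProj`, `modeProj_comp_perm`, `cellOccupation_planeWaveMode_zero`]. -/
def Sig.stub_countLaw : Prop :=
  CountLaw

/-- Registered signature of `stub_localConstancy` [L; templates `vb_localConstancy` and
`condensateOccupation_le_of_nearMinimisers`; new: `Q_S` masses are dilation invariant]. -/
def Sig.stub_localConstancy : Prop :=
  CountLaw → ∀ v : ℝ → ℝ≥0∞, IsRepulsiveFiniteRange v → IsFiniteContinuous v → LocalConstancy v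

/-- Registered signature of `stub_ivtGlue` [L; the connectedness assembly, template `stub_volumeBootstrap`]:
constants `θ = β = 1/8 → (τ, ρ₀ˢ, N₀ˢ)` seed `→ η = (1−2τ)/4 →` band `(ε := η) →` corner `(ε := β(τ+η)/2)`; on the
path `[L_N, max L_N (A·N)]` every side is `good` (all small-slack near-minimisers have `hiMass > 1−τ−η`) or `bad`
(`hiMass < τ`) by `CountLaw` (1) + band + seed + `LocalConstancy` at `L' = L₁`; `good` is locally constant
(`LocalConstancy`), the top is good (corner), `isPreconnected_Icc` ⇒ `L_N` is good ⇒
`⟨n̂₀⟩ ≥ (1−β)(1−τ−η)N` for the `δ`-near-minimisers at `L_N = sideLength ρ N`. -/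
def Sig.stub_ivtGlue : Prop :=
  CountLaw → NoBalancedCat → ∀ v : ℝ → ℝ≥0∞, IsRepulsiveFiniteRange v →
    BandEmptiness v → FreeCorner v → LocalConstancy v → PeriodicBECFor v

/-- Registered signature of `stub_roughPotentials` [XL; the regime outside the finite-continuous class — hard
cores and discontinuous profiles — given GD, the seed and the soft conclusion (inherited GD for `v ∧ n` at fixed
`(N, L)`, Dyson-dressed projected witnesses, Mosco continuity in `L`; or a hard ⇐ soft comparison theorem);
implied by the crux (`roughPotentials_of_gdTransfer`)]. -/
def Sig.stub_roughPotentials : Prop :=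
  GaussianDominationCan → NoBalancedCat →
    (∀ v : ℝ → ℝ≥0∞, IsRepulsiveFiniteRange v → IsFiniteContinuous v → PeriodicBECFor v) →
    ∀ v : ℝ → ℝ≥0∞, IsRepulsiveFiniteRange v → ¬ IsFiniteContinuous v → PeriodicBECFor v

/-! ## §3 Composition (sorry-free): the seven statements give the crux BY NAME -/

/-- **The line concludes the crux BY NAME.**  Finite continuous profiles through the connectedness assembly
(count law, seed, band emptiness from GD, free corner, local constancy); the other admissible profiles through
`stub_roughPotentials` fed with that conclusion. -/
theorem GDTransfer_of :
    Sig.stub_noBalancedCat → Sig.stub_projectedDichotomy → Sig.stub_freeCorner → Sig.stub_countLaw →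
      Sig.stub_localConstancy → Sig.stub_ivtGlue → Sig.stub_roughPotentials → GDTransfer := by
  intro hSeed hDich hCorner hCount hLoc hIvt hRough
  rw [gdTransfer_iff]
  intro hG v hv
  have hsoft : ∀ w : ℝ → ℝ≥0∞, IsRepulsiveFiniteRange w → IsFiniteContinuous w → PeriodicBECFor w :=
    fun w hw hfc => hIvt hCount hSeed w hw (hDich hG w hw hfc) (hCorner w hw) (hLoc hCount w hw hfc)
  by_cases hfc : IsFiniteContinuous v
  · exact hsoft v hv hfc
  · exact hRough hG hSeed hsoft v hv hfc

/-! ## §4 Sanity (sorry-free) -/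

/-- The inline `Q` of the seed IS `modeProj` and its masses ARE `compMass` (definitionally), so the seed reads
`¬(τ ≤ loMass ∧ τ ≤ hiMass)`. -/
theorem noBalancedCat_iff :
    NoBalancedCat ↔
      ∀ v : ℝ → ℝ≥0∞, IsRepulsiveFiniteRange v → ∀ θ β : ℝ, 0 < θ → 0 < β → θ + β < 1 →
        ∃ τ : ℝ, 0 < τ ∧ τ < 1 / 2 ∧ ∃ ρ₀ : ℝ, 0 < ρ₀ ∧ ∃ N₀ : ℕ, ∀ m : ℕ, N₀ ≤ m + 1 → ∀ L : ℝ, 0 < L →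
          ((m + 1 : ℕ) : ℝ) ≤ ρ₀ * L ^ 3 → periodicGroundStateEnergy v (m + 1) L ≠ ⊤ →
          ∃ δ : ℝ≥0∞, 0 < δ ∧ ∀ Ψ : PeriodicTrialState (m + 1) L,
            periodicEnergy v Ψ ≤ periodicGroundStateEnergy v (m + 1) L + δ →
            ¬ (ENNReal.ofReal τ ≤ loMass m L θ Ψ.ψ ∧ ENNReal.ofReal τ ≤ hiMass m L β Ψ.ψ) :=
  Iff.rfl

/-- The rough-potential stub is a weakening of the crux (implied by it). -/
theorem roughPotentials_of_gdTransfer (h : GDTransfer) : Sig.stub_roughPotentials :=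
  fun hG _ _ v hv _ => (gdTransfer_iff.mp h) hG v hv

/-- So is the assembly's conclusion for the finite-continuous class. -/
theorem soft_of_gdTransfer (h : GDTransfer) (hG : GaussianDominationCan) :
    ∀ v : ℝ → ℝ≥0∞, IsRepulsiveFiniteRange v → IsFiniteContinuous v → PeriodicBECFor v :=
  fun v hv _ => (gdTransfer_iff.mp h) hG v hv

/-- The seed's shape is not a Markov costume of the consequent: it holds for ANY law with condensed-side mass
below `τ`, whatever the depleted side (the identically depleted law satisfies it). -/
theorem seed_shape_of_hi_lt {τ p q : ℝ≥0∞} (hq : q < τ) : ¬ (τ ≤ p ∧ τ ≤ q) :=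
  fun h => absurd h.2 (not_le.mpr hq)

end Summit.AtomisticToContinuum.BoseEinsteinCondensation.Cruxes.GDTransfer.Seeded

end
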